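import Literature.Probability.Percolation.HalfPlaneOneArmQuasiMultiplicativity
import HarnessLib

/-!
# Half-plane gluing for the free-side touch bound: a ring of four strip crossings, a connector, and the arm
# (line `potential-darboux-picard-diamond`, S3 (c) `freeTouchLower_of_diagArmLower`, part 1)

Crux `ParafermionToSLESixFamilies` (stmt-CriticalPhenomena-11389), route `CardyComplexCone`, line
`potential-darboux-picard-diamond`, conditional helper `freeTouchLower_of_diagArmLower : DiagHalfPlaneOneArmLower →
FreeTouchLower` of S3. The touch probability `P(x ↔ A)` of a touch site `x` of a free diagonal side is bounded below by
gluing the diagonal half-plane arm at `x` to the wired arc through a ring of four long strip crossings inside the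
diamond and one short connector crossing ending on the wired arc (Harris–FKG, RSW). This file is the DETERMINISTIC and
the abstract PROBABILISTIC half of that gluing, written — like the tree's `Literature.Probability.Percolation.HalfPlaneArm`
toolkit it extends (`uCatch`, `glue`, `meet`, `real_U_ge`, `tb_lower`) — for an abstract pair of integer coordinates
`X, Y : ℤ² → ℤ` that are `1`-Lipschitz along edges and are the real and imaginary parts of an isoradial rhombic drawing:

* `ring_conn` — on the event that the four strips of width `w` along the sides of the box `[L₁, L₂] × [0, T]` are
  crossed the long way, all endpoints of all four crossings are joined inside the box (four applications of `meet`);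
* `connector_conn` — a bottom–top crossing of the connector `[lo, lo + w] × [-1, w]` meets the bottom strip crossing;
* `arm_conn` — the arm `arm[b, 2m]`, the U `U[b, m]` and a bottom–top crossing of `[X b - m, X b + m] × [0, 3m]` join the
  base point `b` to the bottom strip crossing (`glue` + `meet`);
* `real_arm_glue_ge` — `c · P(arm[b, 2m]) · P(R) ≤ P(arm[b, 2m] ∩ U[b, m] ∩ TB ∩ R)` for every increasing measurable `R`;
* `real_arm_shift` — moving the base point of the arm from depth `1` to the boundary row costs a factor `p`.

The transport of these events along lattice automorphisms (uniformity of the constants over the four side frames of a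
diamond) is in the companion file `…DiamondTouchLowerTransport.lean`.
-/

noncomputable section

namespace Summit.CriticalPhenomena.CardyFormulaZ2.Cruxes.ParafermionToSLESixFamilies.PotentialDarbouxPicardDiamond

namespace TouchLower

open MeasureTheory Set
open Literature.Probability.LatticeModels Literature.Probability.Percolation
open Literature.Probability.Percolation.HalfPlaneArm

variable {F : Type*} {emb : RhombicEmbedding (zdGraph 2) F} {κ : ℝ} {X Y : Site 2 → ℤ}

local notation3 "ν[" b ", " v "]" => max |X v - X b| (Y v - Y b)
local notation3 "box[" A₁ ", " A₂ ", " B₁ ", " B₂ "]" =>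
  {v : Site 2 | A₁ ≤ X v ∧ X v ≤ A₂ ∧ B₁ ≤ Y v ∧ Y v ≤ B₂}
local notation3 "LR[" A₁ ", " A₂ ", " B₁ ", " B₂ "]" =>
  openCrossing box[A₁, A₂, B₁, B₂] {v : Site 2 | X v = A₁} {v : Site 2 | X v = A₂}
local notation3 "TB[" A₁ ", " A₂ ", " B₁ ", " B₂ "]" =>
  openCrossing box[A₁, A₂, B₁, B₂] {v : Site 2 | Y v = B₁} {v : Site 2 | Y v = B₂}
local notation3 "LRf[" A ", " B ", " w ", " h "]" =>
  openCrossing {v : Site 2 | A - 2 ≤ X v ∧ X v ≤ A + w + 2 ∧ B ≤ Y v ∧ Y v ≤ B + h}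
    {v : Site 2 | X v ≤ A} {v : Site 2 | A + w ≤ X v}
local notation3 "TBf[" A ", " B ", " w ", " h "]" =>
  openCrossing {v : Site 2 | A ≤ X v ∧ X v ≤ A + w ∧ B - 2 ≤ Y v ∧ Y v ≤ B + h + 2}
    {v : Site 2 | Y v ≤ B} {v : Site 2 | B + h ≤ Y v}
local notation3 "Ubox[" b ", " a "]" => box[X b - 2 * a, X b + 2 * a, 0, Y b + 2 * a]
local notation3 "U[" b ", " a "]" =>
  TB[X b + a, X b + 2 * a, 0, Y b + 2 * a] ∩ LR[X b - 2 * a, X b + 2 * a, Y b + a, Y b + 2 * a] ∩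
    TB[X b - 2 * a, X b - a, 0, Y b + 2 * a]
local notation3 "μ[" p "]" => bondPercolation (zdGraph 2) p
local notation3 "RSW_LR[" p "]" => ∀ k : ℕ, 2 ≤ k → ∃ c : ℝ, 0 < c ∧ ∃ m₀ : ℕ, ∀ m : ℕ, m₀ ≤ m →
  ∀ A B : ℤ, c ≤ (bondPercolation (zdGraph 2) p).real LRf[A, B, (k : ℤ) * m, (m : ℤ)]
local notation3 "RSW_TB[" p "]" => ∀ k : ℕ, 2 ≤ k → ∃ c : ℝ, 0 < c ∧ ∃ m₀ : ℕ, ∀ m : ℕ, m₀ ≤ m →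
  ∀ A B : ℤ, c ≤ (bondPercolation (zdGraph 2) p).real TBf[A, B, (m : ℤ), (k : ℤ) * m]
local notation3 "armbox[" x ", " n "]" => {v : Site 2 | 0 ≤ Y v ∧ ν[x, v] ≤ n}
local notation3 "arm[" x ", " n "]" => openCrossing armbox[x, n] {x} {v : Site 2 | ν[x, v] = n}

/-! ## Deterministic gluing -/

section Det

variable (hX : ∀ u v, (zdGraph 2).Adj u v → X v ≤ X u + 1) (hY : ∀ u v, (zdGraph 2).Adj u v → Y v ≤ Y u + 1)
  (hiso : emb.IsIsoradial) (hrh : emb.IsRhombicTiling) (hκ : 0 < κ)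
  (hre : ∀ v, (emb.z v).re = κ * X v) (him : ∀ v, (emb.z v).im = κ * Y v)

include hiso hrh hκ hre him in

/-- **A horizontal and a vertical strip crossing meet** (bookkeeping instance of `meet`): an open left–right crossing
`a → b` of `[L₁, L₂] × [B₁, B₂]` and an open bottom–top crossing `a' → b'` of `[A₁, A₂] × [C₁, C₂]` with
`L₁ ≤ A₁ < A₂ ≤ L₂`, `C₁ ≤ B₁ < B₂ ≤ C₂` have all four endpoints joined inside the union of the two boxes. -/
theorem cross_conn {ω : BondConfig (Site 2)} (hω : ω ⊆ (zdGraph 2).edgeSet) {L₁ L₂ B₁ B₂ A₁ A₂ C₁ C₂ : ℤ}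
    (hA : A₁ < A₂) (hB : B₁ < B₂) (hLA : L₁ ≤ A₁) (hAL : A₂ ≤ L₂) (hCB : C₁ ≤ B₁) (hBC : B₂ ≤ C₂)
    {a b : Site 2} (ha : X a = L₁) (hb : X b = L₂) (hab : ω ∈ openConnIn box[L₁, L₂, B₁, B₂] a b)
    {a' b' : Site 2} (ha' : Y a' = C₁) (hb' : Y b' = C₂) (hab' : ω ∈ openConnIn box[A₁, A₂, C₁, C₂] a' b') :
    ω ∈ openConnIn (box[L₁, L₂, B₁, B₂] ∪ box[A₁, A₂, C₁, C₂]) a a' ∧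
      ω ∈ openConnIn (box[L₁, L₂, B₁, B₂] ∪ box[A₁, A₂, C₁, C₂]) b a' ∧
      ω ∈ openConnIn (box[L₁, L₂, B₁, B₂] ∪ box[A₁, A₂, C₁, C₂]) a b' ∧
      ω ∈ openConnIn (box[L₁, L₂, B₁, B₂] ∪ box[A₁, A₂, C₁, C₂]) b b' := by
  obtain ⟨m, -, -, ⟨x0, hx0, h1⟩, ⟨y0, hy0, h2⟩, ⟨x1, hx1, h3⟩, ⟨y1, hy1, h4⟩⟩ := meet hiso hrh hκ hre him hω
    (S := box[L₁, L₂, B₁, B₂]) (A := {a}) (B := {b}) (S' := box[A₁, A₂, C₁, C₂]) (A' := {a'}) (B' := {b'})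
    (a₁ := A₁) (a₂ := A₂) (c₁ := B₁) (c₂ := B₂) hA hB
    (fun v hv => ⟨hv.2.2.1, hv.2.2.2⟩) (fun v hv => by rw [mem_singleton_iff.1 hv]; omega)
    (fun v hv => by rw [mem_singleton_iff.1 hv]; omega) (fun v hv => ⟨hv.1, hv.2.1⟩)
    (fun v hv => by rw [mem_singleton_iff.1 hv]; omega) (fun v hv => by rw [mem_singleton_iff.1 hv]; omega)
    ⟨a, mem_singleton _, b, mem_singleton _, hab⟩ ⟨a', mem_singleton _, b', mem_singleton _, hab'⟩
  rw [mem_singleton_iff.1 hx0] at h1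
  rw [mem_singleton_iff.1 hy0] at h2
  rw [mem_singleton_iff.1 hx1] at h3
  rw [mem_singleton_iff.1 hy1] at h4
  -- `h1 : a ↔ m`, `h2 : m ↔ b` in the first box; `h3 : a' ↔ m`, `h4 : m ↔ b'` in the second
  exact ⟨conn_trans subset_union_left subset_union_right h1 (conn_symm h3),
    conn_trans subset_union_left subset_union_right (conn_symm h2) (conn_symm h3),
    conn_trans subset_union_left subset_union_right h1 h4,
    conn_trans subset_union_left subset_union_right (conn_symm h2) h4⟩

include hiso hrh hκ hre him in
/-- **The ring of four strip crossings is connected.** In the box `[L₁, L₂] × [0, T]`, on the event that the bottom strip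
`[L₁, L₂] × [0, w]` and the top strip `[L₁, L₂] × [T - w, T]` are crossed from left to right and the right strip
`[L₂ - w, L₂] × [0, T]` and the left strip `[L₁, L₁ + w] × [0, T]` from bottom to top by open paths, every endpoint of
every such crossing is joined inside the box to the left end `a₀` of any given bottom crossing. -/
theorem ring_conn {ω : BondConfig (Site 2)} (hω : ω ⊆ (zdGraph 2).edgeSet) {L₁ L₂ T w : ℤ} (hw : 1 ≤ w) (hwT : w ≤ T)
    (hL : L₁ + w ≤ L₂)
    (hR : ω ∈ LR[L₁, L₂, 0, w] ∩ TB[L₂ - w, L₂, 0, T] ∩ LR[L₁, L₂, T - w, T] ∩ TB[L₁, L₁ + w, 0, T])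
    {a₀ b₀ : Site 2} (ha₀ : X a₀ = L₁) (hb₀ : X b₀ = L₂) (h₀ : ω ∈ openConnIn box[L₁, L₂, 0, w] a₀ b₀) :
    (∀ a b : Site 2, X a = L₁ → X b = L₂ → ω ∈ openConnIn box[L₁, L₂, 0, w] a b →
      ω ∈ openConnIn box[L₁, L₂, 0, T] a a₀ ∧ ω ∈ openConnIn box[L₁, L₂, 0, T] b a₀) ∧
    (∀ a b : Site 2, Y a = 0 → Y b = T → ω ∈ openConnIn box[L₂ - w, L₂, 0, T] a b →
      ω ∈ openConnIn box[L₁, L₂, 0, T] a a₀ ∧ ω ∈ openConnIn box[L₁, L₂, 0, T] b a₀) ∧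
    (∀ a b : Site 2, X a = L₁ → X b = L₂ → ω ∈ openConnIn box[L₁, L₂, T - w, T] a b →
      ω ∈ openConnIn box[L₁, L₂, 0, T] a a₀ ∧ ω ∈ openConnIn box[L₁, L₂, 0, T] b a₀) ∧
    (∀ a b : Site 2, Y a = 0 → Y b = T → ω ∈ openConnIn box[L₁, L₁ + w, 0, T] a b →
      ω ∈ openConnIn box[L₁, L₂, 0, T] a a₀ ∧ ω ∈ openConnIn box[L₁, L₂, 0, T] b a₀) := by
  obtain ⟨⟨⟨-, ⟨a₁, ha₁, b₁, hb₁, h₁⟩⟩, -⟩, -⟩ := hR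
  have ha₁ : Y a₁ = 0 := ha₁
  have hb₁ : Y b₁ = T := hb₁
  -- the box contains the four strips
  have iH₀ : box[L₁, L₂, 0, w] ⊆ box[L₁, L₂, 0, T] := fun v hv => ⟨hv.1, hv.2.1, hv.2.2.1, by linarith [hv.2.2.2]⟩
  have iV₁ : box[L₂ - w, L₂, 0, T] ⊆ box[L₁, L₂, 0, T] := fun v hv => ⟨by linarith [hv.1], hv.2.1, hv.2.2.1, hv.2.2.2⟩
  have iH₂ : box[L₁, L₂, T - w, T] ⊆ box[L₁, L₂, 0, T] := fun v hv => ⟨hv.1, hv.2.1, by linarith [hv.2.2.1], hv.2.2.2⟩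
  have iV₃ : box[L₁, L₁ + w, 0, T] ⊆ box[L₁, L₂, 0, T] := fun v hv => ⟨hv.1, by linarith [hv.2.1], hv.2.2.1, hv.2.2.2⟩
  -- bottom × right, for any bottom witnesses
  have BR : ∀ a b : Site 2, X a = L₁ → X b = L₂ → ω ∈ openConnIn box[L₁, L₂, 0, w] a b →
      ∀ a' b' : Site 2, Y a' = 0 → Y b' = T → ω ∈ openConnIn box[L₂ - w, L₂, 0, T] a' b' →
      ω ∈ openConnIn box[L₁, L₂, 0, T] a a' ∧ ω ∈ openConnIn box[L₁, L₂, 0, T] b a' ∧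
        ω ∈ openConnIn box[L₁, L₂, 0, T] a b' ∧ ω ∈ openConnIn box[L₁, L₂, 0, T] b b' := by
    intro a b ha hb hab a' b' ha' hb' hab'
    obtain ⟨c1, c2, c3, c4⟩ := cross_conn hiso hrh hκ hre him hω (L₁ := L₁) (L₂ := L₂) (B₁ := 0) (B₂ := w)
      (A₁ := L₂ - w) (A₂ := L₂) (C₁ := 0) (C₂ := T) (by omega) (by omega) (by omega) le_rfl le_rfl hwT ha hb hab ha' hb' hab'
    have hU : box[L₁, L₂, 0, w] ∪ box[L₂ - w, L₂, 0, T] ⊆ box[L₁, L₂, 0, T] := union_subset iH₀ iV₁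
    exact ⟨openConnIn_mono hU _ _ c1, openConnIn_mono hU _ _ c2, openConnIn_mono hU _ _ c3, openConnIn_mono hU _ _ c4⟩
  -- bottom × left
  have BL : ∀ a' b' : Site 2, Y a' = 0 → Y b' = T → ω ∈ openConnIn box[L₁, L₁ + w, 0, T] a' b' →
      ω ∈ openConnIn box[L₁, L₂, 0, T] a₀ a' ∧ ω ∈ openConnIn box[L₁, L₂, 0, T] a₀ b' := by
    intro a' b' ha' hb' hab'
    obtain ⟨c1, -, c3, -⟩ := cross_conn hiso hrh hκ hre him hω (L₁ := L₁) (L₂ := L₂) (B₁ := 0) (B₂ := w)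
      (A₁ := L₁) (A₂ := L₁ + w) (C₁ := 0) (C₂ := T) (by omega) (by omega) le_rfl hL le_rfl hwT ha₀ hb₀ h₀ ha' hb' hab'
    have hU : box[L₁, L₂, 0, w] ∪ box[L₁, L₁ + w, 0, T] ⊆ box[L₁, L₂, 0, T] := union_subset iH₀ iV₃
    exact ⟨openConnIn_mono hU _ _ c1, openConnIn_mono hU _ _ c3⟩
  -- top × right
  have TR : ∀ a b : Site 2, X a = L₁ → X b = L₂ → ω ∈ openConnIn box[L₁, L₂, T - w, T] a b →
      ω ∈ openConnIn box[L₁, L₂, 0, T] a a₁ ∧ ω ∈ openConnIn box[L₁, L₂, 0, T] b a₁ := by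
    intro a b ha hb hab
    obtain ⟨c1, c2, -, -⟩ := cross_conn hiso hrh hκ hre him hω (L₁ := L₁) (L₂ := L₂) (B₁ := T - w) (B₂ := T)
      (A₁ := L₂ - w) (A₂ := L₂) (C₁ := 0) (C₂ := T) (by omega) (by omega) (by omega) le_rfl (by omega) le_rfl
      ha hb hab ha₁ hb₁ h₁
    have hU : box[L₁, L₂, T - w, T] ∪ box[L₂ - w, L₂, 0, T] ⊆ box[L₁, L₂, 0, T] := union_subset iH₂ iV₁
    exact ⟨openConnIn_mono hU _ _ c1, openConnIn_mono hU _ _ c2⟩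
  -- the right witness `a₁` is joined to `a₀`
  obtain ⟨h01, -, -, -⟩ := BR a₀ b₀ ha₀ hb₀ h₀ a₁ b₁ ha₁ hb₁ h₁
  have h10 : ω ∈ openConnIn box[L₁, L₂, 0, T] a₁ a₀ := conn_symm h01
  have tr : ∀ {u v z : Site 2}, ω ∈ openConnIn box[L₁, L₂, 0, T] u v → ω ∈ openConnIn box[L₁, L₂, 0, T] v z →
      ω ∈ openConnIn box[L₁, L₂, 0, T] u z := fun h h' => conn_trans subset_rfl subset_rfl h h'
  refine ⟨fun a b ha hb hab => ?_, fun a b ha hb hab => ?_, fun a b ha hb hab => ?_, fun a b ha hb hab => ?_⟩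
  · obtain ⟨c1, c2, -, -⟩ := BR a b ha hb hab a₁ b₁ ha₁ hb₁ h₁
    exact ⟨tr c1 h10, tr c2 h10⟩
  · obtain ⟨c1, -, c3, -⟩ := BR a₀ b₀ ha₀ hb₀ h₀ a b ha hb hab
    exact ⟨conn_symm c1, conn_symm c3⟩
  · obtain ⟨c1, c2⟩ := TR a b ha hb hab
    exact ⟨tr c1 h10, tr c2 h10⟩
  · obtain ⟨c1, c3⟩ := BL a b ha hb hab
    exact ⟨conn_symm c1, conn_symm c3⟩

include hiso hrh hκ hre him in
/-- **The connector meets the bottom strip crossing.** A bottom–top open crossing `y → t` of the connector box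
`[lo, lo + w] × [-1, w]` (`L₁ ≤ lo`, `lo + w ≤ L₂`) and a left–right open crossing `a₀ → b₀` of the bottom strip
`[L₁, L₂] × [0, w]` pass through a common vertex: `y` is joined to `a₀` inside the union of the two boxes. -/
theorem connector_conn {ω : BondConfig (Site 2)} (hω : ω ⊆ (zdGraph 2).edgeSet) {L₁ L₂ w lo : ℤ} (hw : 1 ≤ w)
    (hlo : L₁ ≤ lo) (hlo' : lo + w ≤ L₂) {y t : Site 2} (hy : Y y = -1) (ht : Y t = w)
    (hQ : ω ∈ openConnIn box[lo, lo + w, -1, w] y t)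
    {a₀ b₀ : Site 2} (ha₀ : X a₀ = L₁) (hb₀ : X b₀ = L₂) (h₀ : ω ∈ openConnIn box[L₁, L₂, 0, w] a₀ b₀) :
    ω ∈ openConnIn (box[L₁, L₂, 0, w] ∪ box[lo, lo + w, -1, w]) y a₀ := by
  obtain ⟨c1, -, -, -⟩ := cross_conn hiso hrh hκ hre him hω (L₁ := L₁) (L₂ := L₂) (B₁ := 0) (B₂ := w)
    (A₁ := lo) (A₂ := lo + w) (C₁ := -1) (C₂ := w) (by omega) (by omega) hlo hlo' (by omega) le_rfl ha₀ hb₀ h₀ hy ht hQ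
  exact conn_symm c1

include hX hY hiso hrh hκ hre him in
/-- **The arm is glued to the bottom strip crossing.** On a lattice configuration in `arm[b, 2m] ∩ U[b, m]` (base point
`b` on the row `Y = 0`) with an open bottom–top crossing `p → r` of the box `[X b - m, X b + m] × [0, 3m]` and an open
left–right crossing `a₀ → b₀` of the bottom strip `[L₁, L₂] × [0, w]` (`w ≤ 3m`, `L₁ ≤ X b - 2m`, `X b + 2m ≤ L₂`), the
base point is joined to `a₀` inside the union of the four regions: the arm and the crossing `p → r` both escape from
`ν ≤ m` to `ν ≥ 2m`, so the U glues them (`glue`), and the crossing `p → r` meets the strip crossing (`meet`). -/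
theorem arm_conn {ω : BondConfig (Site 2)} (hω : ω ⊆ (zdGraph 2).edgeSet) {b : Site 2} (hb : Y b = 0) {m : ℤ}
    (hm : 1 ≤ m) {L₁ L₂ w : ℤ} (hw : 1 ≤ w) (hw3 : w ≤ 3 * m) (hL₁ : L₁ ≤ X b - 2 * m) (hL₂ : X b + 2 * m ≤ L₂)
    (hA : ω ∈ arm[b, 2 * m]) (hU : ω ∈ U[b, m]) {p r : Site 2} (hp : Y p = 0) (hr : Y r = 3 * m)
    (hV : ω ∈ openConnIn box[X b - m, X b + m, 0, 3 * m] p r)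
    {a₀ b₀ : Site 2} (ha₀ : X a₀ = L₁) (hb₀ : X b₀ = L₂) (h₀ : ω ∈ openConnIn box[L₁, L₂, 0, w] a₀ b₀) :
    ω ∈ openConnIn (armbox[b, 2 * m] ∪ box[X b - m, X b + m, 0, 3 * m] ∪ Ubox[b, m] ∪ box[L₁, L₂, 0, w]) b a₀ := by
  obtain ⟨x, hx, e, he, hxe⟩ := hA
  rw [mem_singleton_iff] at hx
  subst hx
  have he : ν[x, e] = 2 * m := he
  have hpV : p ∈ box[X x - m, X x + m, 0, 3 * m] := hV.1
  -- the U glues the arm to the vertical crossing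
  have g := glue hX hY hiso hrh hκ hre him hω (b := x) (by rw [hb]) hm hU (S := armbox[x, 2 * m]) (fun v hv => hv.1) hxe
    (by simp only [sub_self, abs_zero, max_self]; omega) (by omega) (S' := box[X x - m, X x + m, 0, 3 * m])
    (fun v hv => hv.2.2.1) hV (max_le (by rw [abs_le]; constructor <;> linarith [hpV.1, hpV.2.1]) (by rw [hp, hb]; omega))
    (le_max_of_le_right (by rw [hr, hb]; omega))
  -- the vertical crossing meets the strip crossing
  obtain ⟨c1, -, -, -⟩ := cross_conn hiso hrh hκ hre him hω (L₁ := L₁) (L₂ := L₂) (B₁ := 0) (B₂ := w)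
    (A₁ := X x - m) (A₂ := X x + m) (C₁ := 0) (C₂ := 3 * m) (by omega) (by omega) (by omega) (by omega) le_rfl hw3
    ha₀ hb₀ h₀ hp hr hV
  -- `x ↔ p ↔ a₀`
  refine conn_trans subset_union_left ?_ g (conn_symm c1)
  rintro v (hv | hv)
  · exact Or.inr hv
  · exact Or.inl (Or.inl (Or.inr hv))

end Det

/-! ## Probability: Harris–FKG gluing, base-point shift -/

/-- An open edge inside `S` is an open connection inside `S`. -/
theorem openConnIn_of_mem {ω : BondConfig (Site 2)} {S : Set (Site 2)} {x y : Site 2} (he : s(x, y) ∈ ω) (hne : x ≠ y)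
    (hx : x ∈ S) (hy : y ∈ S) : ω ∈ openConnIn S x y := by
  refine ⟨hx, hy, SimpleGraph.Adj.reachable ?_⟩
  rw [SimpleGraph.induce_adj, openGraph_adj]
  exact ⟨he, hne⟩

section Prob

variable (hX : ∀ u v, (zdGraph 2).Adj u v → X v ≤ X u + 1) (hY : ∀ u v, (zdGraph 2).Adj u v → Y v ≤ Y u + 1)
  (hInj : Function.Injective fun v : Site 2 => (X v, Y v))

include hX hY hInj in
/-- **Harris–FKG for the arm gluing**: there are `c > 0` and `m₀` such that for every base point `b` on the row `Y = 0`,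
every `m ≥ m₀` and every increasing measurable event `R`,
`c · P(arm[b, 2m]) · P(R) ≤ P(arm[b, 2m] ∩ U[b, m] ∩ TB([X b - m, X b + m] × [0, 3m]) ∩ R)`
(`P(U[b, m]) ≥ c_U` by `real_U_ge`, the bottom–top crossing has probability `≥ c_V` by `tb_lower`, all four events are
increasing). -/
theorem real_arm_glue_ge (p : unitInterval) (rswLR : RSW_LR[p]) (rswTB : RSW_TB[p]) :
    ∃ c : ℝ, 0 < c ∧ ∃ m₀ : ℕ, ∀ (b : Site 2) (m : ℤ), Y b = 0 → (m₀ : ℤ) ≤ m →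
      ∀ R : Set (BondConfig (Site 2)), IsUpperSet R → MeasurableSet R →
        c * (μ[p]).real arm[b, 2 * m] * (μ[p]).real R ≤
          (μ[p]).real (arm[b, 2 * m] ∩ U[b, m] ∩ TB[X b - m, X b + m, 0, 3 * m] ∩ R) := by
  obtain ⟨cU, hcU, mU, hU⟩ := real_U_ge hX hY hInj p rswLR rswTB
  obtain ⟨cV, hcV, mV, hV⟩ := tb_lower hY p rswTB 2
  refine ⟨cU * cV, by positivity, max mU mV + 1, fun b m hb hm R hR hRm => ?_⟩
  have hm' : ((max mU mV + 1 : ℕ) : ℤ) = max (mU : ℤ) (mV : ℤ) + 1 := by push_cast; rfl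
  rw [hm'] at hm
  have hmU : (mU : ℤ) ≤ max (mU : ℤ) (mV : ℤ) := le_max_left _ _
  have hmV : (mV : ℤ) ≤ max (mU : ℤ) (mV : ℤ) := le_max_right _ _
  have hm0 : 0 ≤ m := by omega
  have eU : cU ≤ (μ[p]).real U[b, m] := hU b m (by rw [hb]) (by omega) (by rw [hb]; exact hm0)
  have hcast : (((2 * m).toNat : ℕ) : ℤ) = 2 * m := Int.toNat_of_nonneg (by omega)
  have h2m : mV ≤ (2 * m).toNat := by
    have : ((mV : ℕ) : ℤ) ≤ ((2 * m).toNat : ℤ) := by rw [hcast]; omega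
    exact_mod_cast this
  have eV : cV ≤ (μ[p]).real TB[X b - m, X b + m, 0, 3 * m] := by
    have := hV (2 * m).toNat h2m (X b - m) 0 (3 * m) (by omega) (by rw [hcast]; omega)
    rw [hcast, zero_add] at this
    convert this using 4; ring
  have finA := armbox_finite hInj b (2 * m)
  have finB := box_finite hInj
  have mA : MeasurableSet (arm[b, 2 * m]) := measurableSet_openCrossing_of_finite finA _ _
  have mUev : MeasurableSet (U[b, m]) :=
    ((measurableSet_openCrossing_of_finite (finB _ _ _ _) _ _).inter
      (measurableSet_openCrossing_of_finite (finB _ _ _ _) _ _)).inter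
      (measurableSet_openCrossing_of_finite (finB _ _ _ _) _ _)
  have uU : IsUpperSet (U[b, m]) :=
    ((isUpperSet_openCrossing _ _ _).inter (isUpperSet_openCrossing _ _ _)).inter (isUpperSet_openCrossing _ _ _)
  have mVev : MeasurableSet (TB[X b - m, X b + m, 0, 3 * m]) := measurableSet_openCrossing_of_finite (finB _ _ _ _) _ _
  have h3 := harris₃ p (isUpperSet_openCrossing _ _ _) uU (isUpperSet_openCrossing _ _ _) mA mUev mVev
  have h4 := harris_fkg_holds (zdGraph 2) p (((isUpperSet_openCrossing _ _ _).inter uU).inter (isUpperSet_openCrossing _ _ _))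
    hR ((mA.inter mUev).inter mVev) hRm
  calc cU * cV * (μ[p]).real arm[b, 2 * m] * (μ[p]).real R
      = (μ[p]).real arm[b, 2 * m] * cU * cV * (μ[p]).real R := by ring
    _ ≤ (μ[p]).real arm[b, 2 * m] * (μ[p]).real U[b, m] * (μ[p]).real TB[X b - m, X b + m, 0, 3 * m] *
          (μ[p]).real R := by gcongr
    _ ≤ (μ[p]).real (arm[b, 2 * m] ∩ U[b, m] ∩ TB[X b - m, X b + m, 0, 3 * m]) * (μ[p]).real R :=
        mul_le_mul_of_nonneg_right h3 measureReal_nonneg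
    _ ≤ _ := h4

include hX hY hInj in
/-- **Moving the base point of the arm onto the boundary row.** For neighbouring sites `b₀` (on the row `Y = 0`) and
`b₁` (in the half-plane, within one unit of `b₀` in each coordinate): `p · P(arm[b₁, n]) ≤ P(arm[b₀, n - 1])` for
`n ≥ 1` — open the edge `b₀ b₁` (Harris–FKG) and stop the resulting open path from `b₀` at its first visit to
`{ν[b₀, ·] = n - 1}`. -/
theorem real_arm_shift (p : unitInterval) {b₀ b₁ : Site 2} (hadj : (zdGraph 2).Adj b₀ b₁) (hb₀ : Y b₀ = 0)
    (hX01 : |X b₁ - X b₀| ≤ 1) (hY01 : |Y b₁ - Y b₀| ≤ 1) {n : ℤ} (hn : 1 ≤ n) :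
    (p : ℝ) * (μ[p]).real arm[b₁, n] ≤ (μ[p]).real arm[b₀, n - 1] := by
  set O : Set (BondConfig (Site 2)) := {ω | s(b₀, b₁) ∈ ω} with hO
  have hez : s(b₀, b₁) ∈ (zdGraph 2).edgeSet := (SimpleGraph.mem_edgeSet _).2 hadj
  have hOp : (μ[p]).real O = p := by rw [hO, bondPercolation_cylinder (zdGraph 2) p hez]
  have hX10 : |X b₀ - X b₁| ≤ 1 := by rw [abs_sub_comm]; exact hX01
  have hY10 : |Y b₀ - Y b₁| ≤ 1 := by rw [abs_sub_comm]; exact hY01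
  -- `arm[b₁, n] ∩ O ⊆ arm[b₀, n - 1]` almost surely
  have hsub : (μ[p]).real (arm[b₁, n] ∩ O) ≤ (μ[p]).real arm[b₀, n - 1] := by
    refine ENNReal.toReal_mono (measure_ne_top _ _) (measure_mono_ae ?_)
    filter_upwards [ae_subset_edgeSet (zdGraph 2) p] with ω hω h
    obtain ⟨⟨x, hx, y, hy, hxy⟩, hωO⟩ := h
    rw [mem_singleton_iff] at hx
    subst hx
    have hy : ν[x, y] = n := hy
    have hωO : s(b₀, x) ∈ ω := hωO
    have hAS : armbox[x, n] ⊆ {v : Site 2 | 0 ≤ Y v ∧ ν[b₀, v] ≤ n + 1} := fun v hv => by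
      have h2 := hv.2
      have := norm_le_norm_add_one hX01 hY01 v
      exact ⟨hv.1, by omega⟩
    have hb₀S : b₀ ∈ {v : Site 2 | 0 ≤ Y v ∧ ν[b₀, v] ≤ n + 1} :=
      ⟨hb₀.ge, by simp only [sub_self, abs_zero, max_self]; omega⟩
    have h01 : ω ∈ openConnIn {v : Site 2 | 0 ≤ Y v ∧ ν[b₀, v] ≤ n + 1} b₀ x :=
      openConnIn_of_mem hωO hadj.ne hb₀S (hAS hxy.1)
    have h0y : ω ∈ openConnIn {v : Site 2 | 0 ≤ Y v ∧ ν[b₀, v] ≤ n + 1} b₀ y := conn_trans subset_rfl hAS h01 hxy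
    have hyn : n - 1 ≤ ν[b₀, y] := by have := norm_le_norm_add_one hX10 hY10 y; omega
    obtain ⟨z, hz, hconn⟩ := exists_openConnIn_le_level hω (fun v => ν[b₀, v]) (norm_le_of_adj hX hY b₀) (n - 1)
      (by simp only [sub_self, abs_zero, max_self]; omega) hyn h0y
    refine mem_openCrossing_iff.2 ⟨b₀, mem_singleton _, z, hz, openConnIn_mono ?_ _ _ hconn⟩
    exact fun v hv => ⟨hv.1.1, hv.2⟩
  have hH : (μ[p]).real arm[b₁, n] * (μ[p]).real O ≤ (μ[p]).real (arm[b₁, n] ∩ O) :=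
    harris_fkg_holds (zdGraph 2) p (isUpperSet_openCrossing _ _ _) (fun _ _ h he => h he : IsUpperSet O)
      (measurableSet_openCrossing_of_finite (armbox_finite hInj b₁ n) _ _) (measurableSet_mem _)
  rw [hOp] at hH
  calc (p : ℝ) * (μ[p]).real arm[b₁, n] = (μ[p]).real arm[b₁, n] * p := by ring
    _ ≤ (μ[p]).real (arm[b₁, n] ∩ O) := hH
    _ ≤ _ := hsub

end Prob


end TouchLower

open Literature.Probability.LatticeModels Literature.Probability.Percolation in
/-- **Registered form of `TouchLower.real_arm_shift`** (helper of `freeTouchLower_of_diagArmLower`): for abstract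
`1`-Lipschitz, jointly injective integer coordinates `X, Y` of `ℤ²`, neighbouring base points `b₀` (on the row `Y = 0`) and
`b₁` (within one unit of `b₀` in each coordinate) and `n ≥ 1`, the half-plane one-arm probabilities satisfy
`p · P(arm[b₁, n]) ≤ P(arm[b₀, n − 1])`. -/
theorem touchLower_real_arm_shift : ∀ (X Y : Site 2 → ℤ), (∀ u v : Site 2, (zdGraph 2).Adj u v → X v ≤ X u + 1) → (∀ u v : Site 2, (zdGraph 2).Adj u v → Y v ≤ Y u + 1) → (Function.Injective fun v : Site 2 => (X v, Y v)) → ∀ (p : unitInterval) (b₀ b₁ : Site 2), (zdGraph 2).Adj b₀ b₁ → Y b₀ = 0 → |X b₁ - X b₀| ≤ 1 → |Y b₁ - Y b₀| ≤ 1 → ∀ n : ℤ, 1 ≤ n → (p : ℝ) * (bondPercolation (zdGraph 2) p).real (openCrossing {v : Site 2 | 0 ≤ Y v ∧ max |X v - X b₁| (Y v - Y b₁) ≤ n} {b₁} {v : Site 2 | max |X v - X b₁| (Y v - Y b₁) = n}) ≤ (bondPercolation (zdGraph 2) p).real (openCrossing {v : Site 2 | 0 ≤ Y v ∧ max |X v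 - X b₀| (Y v - Y b₀) ≤ n - 1} {b₀} {v : Site 2 | max |X v - X b₀| (Y v - Y b₀) = n - 1}) :=
  fun _ _ hX hY hInj p _ _ hadj hb₀ hX01 hY01 _ hn => TouchLower.real_arm_shift hX hY hInj p hadj hb₀ hX01 hY01 hn

end Summit.CriticalPhenomena.CardyFormulaZ2.Cruxes.ParafermionToSLESixFamilies.PotentialDarbouxPicardDiamond

end
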